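import Mathlib
import Summits.AnomalousDissipation.AnomalousDissipation.Theorems.SoloBlindTailSqIntegral

/-!
# Solo-blind kernel #284 — the outer tail of the shifted-line energy from an `O(1/t³)` remainder

ENGINE-L-SPEC §15(o.3′) STEP 5: once the expansion-at-infinity lemma gives `‖R(t)‖ ≤ C/t³` for
`t > T1 > 0` (the `1/t` and `1/t²` terms being matched by the model), the outer tail of
`Q0′ = (2π)⁻¹∫‖R‖²` is bounded by `C²/(5 T1⁵)` — the FIFTH power is what lets the certified outer chain
stop at a moderate `T1`.  `outer_tail_sq_le` (domination by `C² t⁻⁶`, #263 `integral_inv_pow`), with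
integrability, for `R` with values in any normed group; `outer_tail_sq_le'` is the `T₊`-shaped
statement consumed by #280 `line_quadrature`.
-/

namespace Summit.AnomalousDissipation.SoloBlind.OuterTail

open MeasureTheory Set
open Summit.AnomalousDissipation.SoloBlind.TailSqIntegral

variable {E : Type*} [NormedAddCommGroup E]

/-- **Outer tail**: `‖R t‖ ≤ C/t³` on `t > T1 > 0` (and `‖R‖²` a.e.-strongly measurable there) ⇒
`‖R‖²` integrable on `(T1, ∞)` with `∫_{T1}^∞ ‖R‖² ≤ C²/(5 T1⁵)`. -/
theorem outer_tail_sq_le {R : ℝ → E} {C T1 : ℝ} (hT1 : 0 < T1)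
    (hmeas : AEStronglyMeasurable (fun t => ‖R t‖ ^ 2) (volume.restrict (Ioi T1)))
    (hR : ∀ t, T1 < t → ‖R t‖ ≤ C / t ^ 3) :
    IntegrableOn (fun t => ‖R t‖ ^ 2) (Ioi T1) ∧
      ∫ t in Ioi T1, ‖R t‖ ^ 2 ≤ C ^ 2 / (5 * T1 ^ 5) := by
  have hdom_int : IntegrableOn (fun t : ℝ => C ^ 2 * (t ^ (4 + 2))⁻¹) (Ioi T1) :=
    (integrableOn_inv_pow hT1 4).const_mul (C ^ 2)
  have hpt : ∀ t ∈ Ioi T1, ‖R t‖ ^ 2 ≤ C ^ 2 * (t ^ (4 + 2))⁻¹ := by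
    intro t ht
    have ht0 : 0 < t := lt_trans hT1 ht
    have hC : 0 ≤ C / t ^ 3 := le_trans (norm_nonneg _) (hR t ht)
    have h1 : ‖R t‖ ^ 2 ≤ (C / t ^ 3) ^ 2 := pow_le_pow_left₀ (norm_nonneg _) (hR t ht) 2
    have h2 : (C / t ^ 3) ^ 2 = C ^ 2 * (t ^ (4 + 2))⁻¹ := by
      rw [div_pow, ← pow_mul, div_eq_mul_inv]
    linarith [h2.le, h2.ge]
  have hint : IntegrableOn (fun t => ‖R t‖ ^ 2) (Ioi T1) := by
    refine Integrable.mono' hdom_int hmeas ?_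
    refine (ae_restrict_iff' measurableSet_Ioi).2 (Filter.Eventually.of_forall fun t ht => ?_)
    rw [Real.norm_of_nonneg (sq_nonneg _)]
    exact hpt t ht
  refine ⟨hint, ?_⟩
  calc ∫ t in Ioi T1, ‖R t‖ ^ 2 ≤ ∫ t in Ioi T1, C ^ 2 * (t ^ (4 + 2))⁻¹ :=
        setIntegral_mono_on hint hdom_int measurableSet_Ioi hpt
    _ = C ^ 2 * ((T1 ^ (4 + 1))⁻¹ / ((4 : ℕ) + 1 : ℝ)) := by
        rw [integral_const_mul, integral_inv_pow hT1 4]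
    _ = C ^ 2 / (5 * T1 ^ 5) := by
        have hT : T1 ^ 5 ≠ 0 := pow_ne_zero 5 hT1.ne'
        norm_num
        field_simp

/-- The same in the `T₊` shape of #280 `line_quadrature` (`∫_{(T1,∞)} f ≤ T₊` with `f = ‖R‖²`). -/
theorem outer_tail_sq_le' {R : ℝ → E} {C T1 Thi : ℝ} (hT1 : 0 < T1)
    (hmeas : AEStronglyMeasurable (fun t => ‖R t‖ ^ 2) (volume.restrict (Ioi T1)))
    (hR : ∀ t, T1 < t → ‖R t‖ ≤ C / t ^ 3) (hThi : C ^ 2 / (5 * T1 ^ 5) ≤ Thi) :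
    ∫ t in Ioi T1, ‖R t‖ ^ 2 ≤ Thi :=
  le_trans (outer_tail_sq_le hT1 hmeas hR).2 hThi

end Summit.AnomalousDissipation.SoloBlind.OuterTail
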